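import Literature.NumberTheory.EllipticCurves.ProfiniteGroupDistributionTwisting
import HarnessLib

/-!
# Bounded distributions on a group along a subgroup tower: the division data of de Shalit II.4.12 depend only on
# the CELLS of the auxiliary elements (any two lifts of the same Artin symbols carry the same data)

Topic `NumberTheory/EllipticCurves`; namespace `Literature.NumberTheory.EllipticCurves.SubgroupTower`.

De Shalit 1987, II.4.12 (p. 66–68): the auxiliary ideal `𝔞₁` enters the division step only through its Artin symbols
`σ_{𝔞₁}|_{K(𝔣𝔭^n)}` ("`σ_{𝔞₁}` restricted to `Gal(K(𝔣𝔭^∞)/K(𝔣𝔭^s))` is a topological generator"), i.e. through the cells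
`σ_{𝔞₁} U_n` of ANY lift `σ_{𝔞₁} ∈ Γ_K`.  The tree's division theorem
(`GroupDistribution.exists_twisting_μ_eq_forall_of_units`, `…_induceFrom`, `…_induceFrom_of_subgroup_data`) takes the data
(`σ ∈ U_s`; `σ` generates `U_s` modulo every `U_m`; `p`-power orders of the cells, unbounded; `σ₂^k σ₁^{-k} ∉ ⋂ U_n`) for the
SPECIFIC elements `σ 𝔞ᵢ` of the twist family, while the dischargers (`hgen_artin`, `hpow_artin`, `hunb_artin`, `hτ_artin` of
`RayClassFieldAdicCharacterDivision.lean`) produce them for THEIR OWN lifts.  THIS file is the (trivial) transport: if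
`proj_n σ = proj_n τ` for all `n`, each datum for `τ` is the datum for `σ`:

* `mem_U_iff_of_forall_proj_eq`, `hgen_of_forall_proj_eq`, `hpow_of_forall_proj_eq`, `hunb_of_forall_proj_eq`,
  `hτ_of_forall_proj_eq`.

Everything is a theorem; no named facts, no definitions, no instances, no `sorry`.

## References

* [deShalit1987] E. de Shalit, *Iwasawa theory of elliptic curves with complex multiplication* (1987), II.4.12 (p. 66–69).
-/

noncomputable section

open scoped Classical

namespace Literature.NumberTheory.EllipticCurves

namespace SubgroupTower

variable {G : Type*} [Group G] (𝒰 : SubgroupTower G) [∀ n, (𝒰.U n).Normal]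

/-- Membership in a level is read on the cell: `σ ∈ U_n ↔ proj_n σ = 1`. [cite: deShalit1987, I.3.1 (p. 16)] -/
theorem mem_U_iff_proj_eq_one (n : ℕ) (σ : G) : σ ∈ 𝒰.U n ↔ 𝒰.proj n σ = 1 :=
  (QuotientGroup.eq_one_iff σ).symm

/-- **Membership transported**: if `σ` and `τ` have the same cells at every level then `σ ∈ U_s ↔ τ ∈ U_s`.
[cite: deShalit1987, II.4.12 (p. 66)] -/
theorem mem_U_iff_of_forall_proj_eq {σ τ : G} (h : ∀ n, 𝒰.proj n σ = 𝒰.proj n τ) (s : ℕ) :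
    σ ∈ 𝒰.U s ↔ τ ∈ 𝒰.U s := by
  rw [𝒰.mem_U_iff_proj_eq_one, 𝒰.mem_U_iff_proj_eq_one, h s]

/-- **`hgen` transported**: topological generation of `U_s` modulo every `U_m` depends only on the cells of the generator.
[cite: deShalit1987, II.4.12 (p. 66–68)] -/
theorem hgen_of_forall_proj_eq {σ τ : G} (h : ∀ n, 𝒰.proj n σ = 𝒰.proj n τ) {s : ℕ}
    (hgen : ∀ m, s ≤ m → ∀ u ∈ 𝒰.U s, ∃ k : ℕ, 𝒰.proj m (τ ^ k) = 𝒰.proj m u) :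
    ∀ m, s ≤ m → ∀ u ∈ 𝒰.U s, ∃ k : ℕ, 𝒰.proj m (σ ^ k) = 𝒰.proj m u := by
  intro m hm u hu
  obtain ⟨k, hk⟩ := hgen m hm u hu
  exact ⟨k, by rw [𝒰.proj_pow, h m, ← 𝒰.proj_pow, hk]⟩

/-- **`hpow` transported**: the orders of the cells depend only on the cells. [cite: deShalit1987, II.4.12 (p. 68)] -/
theorem hpow_of_forall_proj_eq {σ τ : G} (h : ∀ n, 𝒰.proj n σ = 𝒰.proj n τ) {p s : ℕ}
    (hpow : ∀ n, s ≤ n → ∃ e : ℕ, orderOf (𝒰.proj n τ) = p ^ e) :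
    ∀ n, s ≤ n → ∃ e : ℕ, orderOf (𝒰.proj n σ) = p ^ e := by
  intro n hn
  rw [h n]
  exact hpow n hn

/-- **`hunb` transported**. [cite: deShalit1987, II.4.12 (p. 68)] -/
theorem hunb_of_forall_proj_eq {σ τ : G} (h : ∀ n, 𝒰.proj n σ = 𝒰.proj n τ) {p : ℕ}
    (hunb : ∀ e : ℕ, ∃ m, p ^ e ∣ orderOf (𝒰.proj m τ)) :
    ∀ e : ℕ, ∃ m, p ^ e ∣ orderOf (𝒰.proj m σ) := by
  intro e
  obtain ⟨m, hm⟩ := hunb e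
  exact ⟨m, by rwa [h m]⟩

/-- **`hτ` transported**: `σ₂^k σ₁^{-k} ∉ U_n` depends only on the cells of `σ₁, σ₂`. [cite: deShalit1987, II.4.12 (p. 68–69)] -/
theorem hτ_of_forall_proj_eq {σ₁ τ₁ σ₂ τ₂ : G} (h₁ : ∀ n, 𝒰.proj n σ₁ = 𝒰.proj n τ₁)
    (h₂ : ∀ n, 𝒰.proj n σ₂ = 𝒰.proj n τ₂) {s : ℕ}
    (hτ : ∀ k, 0 < k → ∃ n, s ≤ n ∧ τ₂ ^ k * (τ₁ ^ k)⁻¹ ∉ 𝒰.U n) :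
    ∀ k, 0 < k → ∃ n, s ≤ n ∧ σ₂ ^ k * (σ₁ ^ k)⁻¹ ∉ 𝒰.U n := by
  intro k hk
  obtain ⟨n, hn, hne⟩ := hτ k hk
  refine ⟨n, hn, fun hmem ↦ hne ?_⟩
  rw [𝒰.mem_U_iff_proj_eq_one, 𝒰.proj_mul, 𝒰.proj_inv, 𝒰.proj_pow, 𝒰.proj_pow] at hmem ⊢
  rwa [← h₁ n, ← h₂ n]

omit [∀ n, (𝒰.U n).Normal] in
/-- Two elements with the same image under a group homomorphism whose kernel is the level have the same cell — the
criterion used with `U_n = ker(Γ_K → Gal(K(𝔪v^{n+1})/K))` ("two lifts of the same Artin symbol").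
[cite: deShalit1987, II.4.12 (p. 66)] -/
theorem proj_eq_of_map_eq {G' : Type*} [Group G'] {n : ℕ} (f : G →* G') (hf : 𝒰.U n = f.ker) {σ τ : G}
    (h : f σ = f τ) : 𝒰.proj n σ = 𝒰.proj n τ := by
  rw [𝒰.proj_eq_iff, hf, MonoidHom.mem_ker, map_mul, map_inv, h, inv_mul_cancel]

end SubgroupTower

end Literature.NumberTheory.EllipticCurves

end
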